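import Summits.Ventures.QEC.Census.FoldLin2
import HarnessLib

/-!
# Fold enumeration — completeness of the certified linear solver and of the subset scan

Cell `qec`, PARTITION row type-11 ("kernel C"), soundness layer 2 of `Census/FoldDefs.lean`.
`pivOK cs P` verifies a pivot structure for the column list `cs` (every column re-expands from its
coefficients over the pivot columns; `N` inverts the pivot minor; the reduction `red` kills every
column).  Consequences proved here:
* `test_complete` — every vector of the column span passes `P.test`;
* `red_selXor` — every vector of the column span reduces to `0` (soundness of PRUNING);
* `solutions_complete` — every solution `x` of `⊕_{j ∈ x} cs[j] = v` (read on its low `p` bits) is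
  listed by `P.solutions cs v`;
* `scan_complete` — the include/skip scan visits every sub-list of the outside positions within budget
  whose residual reduces to `0` and lists every solution there.
Only the VERIFIER carries lemmas; the elimination `gaussPiv` that produces the structure is unverified
(a wrong structure fails `pivOK` and the enumerator reports failure).  Linear algebra over `𝔽₂`, folklore.
-/

namespace Summit.Ventures.QEC.Census.Fold

open Summit.Ventures.QEC.Census

/-! ## Additive maps through `lin` -/

/-- `lin g (n+1) 0` peeled at bit `0`. -/
theorem lin_succ_zero (g : ℕ → ℕ) (n x : ℕ) :
    lin g (n + 1) 0 x = (if x % 2 = 1 then g 0 else 0) ^^^ lin (fun k => g (k + 1)) n 0 (x / 2) := by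
  rw [lin_succ]
  congr 1
  have : ∀ (m i0 : ℕ) (w : ℕ), lin g m (i0 + 1) w = lin (fun k => g (k + 1)) m i0 w := by
    intro m
    induction m with
    | zero => intro i0 w; rfl
    | succ m ih => intro i0 w; rw [lin_succ, lin_succ, ih]
  exact this n 0 (x / 2)

/-- An additive map commutes with `lin`: `f (lin h n 0 x) = lin (f ∘ h) n 0 x`. -/
theorem map_lin_of_xor (f : ℕ → ℕ) (hf0 : f 0 = 0) (hf : ∀ a b, f (a ^^^ b) = f a ^^^ f b)
    (h : ℕ → ℕ) (n : ℕ) : ∀ x, f (lin h n 0 x) = lin (fun k => f (h k)) n 0 x := by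
  induction n generalizing h with
  | zero => intro x; simp [hf0]
  | succ n ih =>
    intro x
    rw [lin_succ_zero, lin_succ_zero, hf, ih (fun k => h (k + 1))]
    congr 1
    split
    · rfl
    · exact hf0

/-- `lin` of a pointwise xor of coefficient functions. -/
theorem lin_xor_fun (g h : ℕ → ℕ) (n : ℕ) : ∀ (i0 x : ℕ),
    lin (fun k => g k ^^^ h k) n i0 x = lin g n i0 x ^^^ lin h n i0 x := by
  induction n with
  | zero => intro i0 x; simp
  | succ n ih =>
    intro i0 x
    simp only [lin_succ, ih]
    split
    · rw [Nat.xor_assoc, Nat.xor_assoc, ← Nat.xor_assoc (h i0), Nat.xor_comm (h i0) (lin g n _ _),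
        Nat.xor_assoc]
    · simp

/-- `lin` of the zero coefficient function. -/
theorem lin_const_zero (n : ℕ) : ∀ (i0 x : ℕ), lin (fun _ => 0) n i0 x = 0 := by
  induction n with
  | zero => intro i0 x; rfl
  | succ n ih => intro i0 x; rw [lin_succ, ih]; simp

/-! ## `selXor`, `selXorL`, `restrictTo`, `coef`, `embedI`, `red` are additive -/

/-- The list-serial selector is the `lin` selector. -/
theorem selXorL_eq (L : List ℕ) : ∀ x, selXorL L x = selXor L x := by
  induction L with
  | nil => intro x; simp [selXorL, selXor]
  | cons c L ih =>
    intro x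
    rw [selXorL, selXor, List.length_cons, lin_succ_zero, ih, selXor]
    simp only [List.getD_cons_zero, List.getD_cons_succ]

/-- `selXor_xor`: selXor xor (auxiliary lemma of the fold-certificate soundness chain). -/
theorem selXor_xor (L : List ℕ) (x y : ℕ) : selXor L (x ^^^ y) = selXor L x ^^^ selXor L y :=
  lin_xor _ _ _ _ _

/-- `selXor_zero`: selXor zero (auxiliary lemma of the fold-certificate soundness chain). -/
@[simp] theorem selXor_zero (L : List ℕ) : selXor L 0 = 0 := lin_zero _ _ _

/-- `selXor_mod`: selXor mod (auxiliary lemma of the fold-certificate soundness chain). -/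
theorem selXor_mod (L : List ℕ) (x : ℕ) : selXor L (x % 2 ^ L.length) = selXor L x := lin_mod _ _ _ _

/-- `restrictTo_xor`: restrictTo xor (auxiliary lemma of the fold-certificate soundness chain). -/
theorem restrictTo_xor (R : List ℕ) : ∀ (k0 v w : ℕ),
    restrictTo R k0 (v ^^^ w) = restrictTo R k0 v ^^^ restrictTo R k0 w := by
  induction R with
  | nil => intro k0 v w; simp [restrictTo]
  | cons r R ih =>
    intro k0 v w
    simp only [restrictTo, Nat.testBit_xor, ih]
    cases v.testBit r <;> cases w.testBit r <;> simp [Nat.xor_assoc, Nat.xor_left_comm]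

/-- `restrictTo_zero`: restrictTo zero (auxiliary lemma of the fold-certificate soundness chain). -/
@[simp] theorem restrictTo_zero (R : List ℕ) (k0 : ℕ) : restrictTo R k0 0 = 0 := by
  induction R generalizing k0 with
  | nil => rfl
  | cons r R ih => simp [restrictTo, ih]

/-- `coef_eq`: coef eq (auxiliary lemma of the fold-certificate soundness chain). -/
theorem coef_eq (P : Piv) (v : ℕ) : P.coef v = selXor P.N (restrictTo P.R 0 v) := by
  rw [Piv.coef, selXorL_eq]

/-- `coef_xor`: coef xor (auxiliary lemma of the fold-certificate soundness chain). -/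
theorem coef_xor (P : Piv) (v w : ℕ) : P.coef (v ^^^ w) = P.coef v ^^^ P.coef w := by
  rw [coef_eq, coef_eq, coef_eq, restrictTo_xor, selXor_xor]

/-- `coef_zero`: coef zero (auxiliary lemma of the fold-certificate soundness chain). -/
@[simp] theorem coef_zero (P : Piv) : P.coef 0 = 0 := by simp [coef_eq]

/-- `embedI_eq`: embedI eq (auxiliary lemma of the fold-certificate soundness chain). -/
theorem embedI_eq (P : Piv) (y : ℕ) : P.embedI y = selXor (P.I.map fun i => 2 ^ i) y := by
  rw [Piv.embedI, selXorL_eq]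

/-- `embedI_xor`: embedI xor (auxiliary lemma of the fold-certificate soundness chain). -/
theorem embedI_xor (P : Piv) (x y : ℕ) : P.embedI (x ^^^ y) = P.embedI x ^^^ P.embedI y := by
  rw [embedI_eq, embedI_eq, embedI_eq, selXor_xor]

/-- `embedI_zero`: embedI zero (auxiliary lemma of the fold-certificate soundness chain). -/
@[simp] theorem embedI_zero (P : Piv) : P.embedI 0 = 0 := by simp [embedI_eq]

/-- `embedI_mod`: embedI mod (auxiliary lemma of the fold-certificate soundness chain). -/
theorem embedI_mod (P : Piv) (x : ℕ) : P.embedI (x % 2 ^ P.I.length) = P.embedI x := by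
  have := selXor_mod (P.I.map fun i => 2 ^ i) x
  rw [List.length_map] at this
  rw [embedI_eq, embedI_eq, this]

/-- `red_eq`: red eq (auxiliary lemma of the fold-certificate soundness chain). -/
theorem red_eq (P : Piv) (v : ℕ) : P.red v = v ^^^ selXor P.V (restrictTo P.R 0 v) := by
  rw [Piv.red, selXorL_eq]

/-- The reduction is additive. -/
theorem red_xor (P : Piv) (v w : ℕ) : P.red (v ^^^ w) = P.red v ^^^ P.red w := by
  rw [red_eq, red_eq, red_eq, restrictTo_xor, selXor_xor]
  simp only [Nat.xor_assoc, Nat.xor_left_comm]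

/-- `red_zero`: red zero (auxiliary lemma of the fold-certificate soundness chain). -/
@[simp] theorem red_zero (P : Piv) : P.red 0 = 0 := by simp [red_eq]

/-- The reduction over a `xorIdx`. -/
theorem red_xorIdx {α : Type} (P : Piv) (g : α → ℕ) (L : List α) :
    P.red (xorIdx g L) = xorIdx (fun x => P.red (g x)) L := by
  induction L with
  | nil => simp
  | cons a L ih => rw [xorIdx_cons, red_xor, ih, xorIdx_cons]

/-- `lin` of list entries lies in `spanAll` of the nonzero entries. -/
theorem lin_getD_mem_spanAll (M : List ℕ) :
    ∀ x, lin (fun j => M.getD j 0) M.length 0 x ∈ spanAll (M.filter fun k => !(k == 0)) := by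
  induction M with
  | nil => intro x; simp [spanAll]
  | cons k M ih =>
    intro x
    rw [List.length_cons, lin_succ_zero]
    simp only [List.getD_cons_zero, List.getD_cons_succ]
    have ihx := ih (x / 2)
    by_cases hk : k = 0
    · subst hk; simp only [List.filter_cons]; simpa using ihx
    · rw [List.filter_cons_of_pos (by simpa using hk), spanAll]
      simp only [List.mem_append, List.mem_map]
      split
      · exact Or.inr ⟨_, ihx, by rw [Nat.xor_comm]⟩
      · rw [Nat.zero_xor]; exact Or.inl ihx

/-! ## What `pivOK` says -/

section PivOK

variable {cs : List ℕ} {P : Piv} (hP : pivOKcore cs P = true)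
include hP

/-- the bookkeeping conjuncts recorded by `pivOKcore` (lengths, pivot columns, index bounds). -/
private theorem pivOK_parts :
    (P.I.length = P.R.length ∧ P.N.length = P.I.length ∧ P.Z.length = cs.length ∧
      P.PC = P.I.map (fun i => cs.getD i 0) ∧ (∀ i ∈ P.I, i < cs.length)) ∧
    (∀ cj ∈ List.zipIdx cs, selXorL (P.pcols cs) (P.Z.getD cj.2 0) = cj.1) ∧
    (∀ ck ∈ List.zipIdx (P.pcols cs), P.coef ck.1 = 2 ^ ck.2) := by
  simp only [pivOKcore, Bool.and_eq_true, beq_iff_eq, List.all_eq_true, decide_eq_true_eq] at hP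
  obtain ⟨⟨⟨⟨⟨⟨h1, h2⟩, h3⟩, h4⟩, h5⟩, h6⟩, h7⟩ := hP
  exact ⟨⟨h1, h2, h3, h4, h5⟩, h6, h7⟩

/-- `pivOK_PC`: pivOK PC (auxiliary lemma of the fold-certificate soundness chain). -/
theorem pivOK_PC : P.pcols cs = P.I.map fun i => cs.getD i 0 := (pivOK_parts hP).1.2.2.2.1

/-- `pivOK_len_pcols`: pivOK len pcols (auxiliary lemma of the fold-certificate soundness chain). -/
theorem pivOK_len_pcols : (P.pcols cs).length = P.I.length := by rw [pivOK_PC hP, List.length_map]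

/-- `pivOK_len_N`: pivOK len N (auxiliary lemma of the fold-certificate soundness chain). -/
theorem pivOK_len_N : P.N.length = P.I.length := (pivOK_parts hP).1.2.1
/-- `pivOK_len_Z`: pivOK len Z (auxiliary lemma of the fold-certificate soundness chain). -/
theorem pivOK_len_Z : P.Z.length = cs.length := (pivOK_parts hP).1.2.2.1
/-- Column re-expansion: `selXor pcols Z[j] = cs[j]`. -/
theorem pivOK_Z {j : ℕ} (hj : j < cs.length) : selXor (P.pcols cs) (P.Z.getD j 0) = cs.getD j 0 := by
  have h := (pivOK_parts hP).2.1 (cs[j], j) (by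
    rw [List.mem_zipIdx_iff_getElem?]; simp [List.getElem?_eq_getElem hj])
  rw [selXorL_eq] at h
  rw [h, List.getD_eq_getElem?_getD, List.getElem?_eq_getElem hj, Option.getD_some]
/-- Minor inversion: `coef (pcols[k]) = 2^k`. -/
theorem pivOK_N {k : ℕ} (hk : k < P.I.length) : P.coef ((P.pcols cs).getD k 0) = 2 ^ k := by
  have hk' : k < (P.pcols cs).length := by rw [pivOK_len_pcols hP]; exact hk
  have h := (pivOK_parts hP).2.2 ((P.pcols cs)[k], k) (by
    rw [List.mem_zipIdx_iff_getElem?]; simp [List.getElem?_eq_getElem hk'])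
  rw [List.getD_eq_getElem?_getD, List.getElem?_eq_getElem hk', Option.getD_some, h]
/-- The coefficient-sum of a solution: `y(x) = ⊕_{j ∈ x} Z[j]`. -/
theorem selXor_pcols_lin_Z (x : ℕ) :
    selXor (P.pcols cs) (lin (fun j => P.Z.getD j 0) cs.length 0 x) = selXor cs x := by
  rw [map_lin_of_xor (selXor (P.pcols cs)) (selXor_zero _) (selXor_xor _)]
  exact lin_congr (i0 := 0) (fun j hj => by rw [Nat.zero_add]; exact pivOK_Z hP hj) x
/-- `coef` inverts the pivot expansion: `coef (selXor pcols y) = y mod 2^q`. -/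
theorem coef_selXor_pcols (y : ℕ) : P.coef (selXor (P.pcols cs) y) = y % 2 ^ P.I.length := by
  rw [selXor, map_lin_of_xor P.coef (coef_zero P) (coef_xor P), pivOK_len_pcols hP,
    ← lin_pow_self]
  exact lin_congr (i0 := 0) (fun k hk => by rw [Nat.zero_add]; exact pivOK_N hP hk) y
/-- **TEST COMPLETENESS**: every element of the column span passes the membership test. -/
theorem test_complete (x : ℕ) : P.test cs (selXor cs x) = true := by
  rw [Piv.test, beq_iff_eq, selXorL_eq, ← selXor_pcols_lin_Z hP x, coef_selXor_pcols hP,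
    ← pivOK_len_pcols hP, selXor_mod]

/-! ### All solutions -/
/-- **SOLUTION COMPLETENESS**: every solution (on its low `p` bits) is listed. -/
theorem solutions_complete (x : ℕ) : x % 2 ^ cs.length ∈ P.solutions cs (selXor cs x) := by
  rw [Piv.solutions, if_pos (test_complete hP x)]
  simp only [List.mem_map]
  set p := cs.length
  let K : ℕ → ℕ := fun j => 2 ^ j ^^^ P.embedI (P.Z.getD j 0)
  have hcoef : P.embedI (P.coef (selXor cs x)) = P.embedI (lin (fun j => P.Z.getD j 0) p 0 x) := by
    rw [← selXor_pcols_lin_Z hP x, coef_selXor_pcols hP, embedI_mod]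
  have hK : lin K p 0 x = x % 2 ^ p ^^^ P.embedI (lin (fun j => P.Z.getD j 0) p 0 x) := by
    rw [lin_xor_fun, lin_pow_self, map_lin_of_xor P.embedI (embedI_zero P) (embedI_xor P)]
  refine ⟨lin K p 0 x, ?_, ?_⟩
  · have hM := lin_getD_mem_spanAll ((List.range p).map K) x
    rw [List.length_map, List.length_range] at hM
    rw [Piv.kerGens]
    have : lin (fun j => ((List.range p).map K).getD j 0) p 0 x = lin K p 0 x :=
      lin_congr (i0 := 0) (fun j hj => by
        rw [Nat.zero_add, List.getD_eq_getElem?_getD, List.getElem?_map, List.getElem?_range hj]; rfl) x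
    rw [this] at hM
    exact hM
  · rw [hcoef, hK, ← Nat.xor_assoc, Nat.xor_comm (P.embedI _), Nat.xor_assoc, Nat.xor_self, Nat.xor_zero]

end PivOK
/-- `pivOKcore_of_pivOK`: pivOKcore of pivOK (auxiliary lemma of the fold-certificate soundness chain). -/
theorem pivOKcore_of_pivOK {cs : List ℕ} {P : Piv} (hP : pivOK cs P = true) : pivOKcore cs P = true := by
  rw [pivOK, Bool.and_eq_true] at hP; exact hP.1
/-- The reduction kills every column. -/
theorem pivOK_red {cs : List ℕ} {P : Piv} (hP : pivOK cs P = true) {j : ℕ} (hj : j < cs.length) :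
    P.red (cs.getD j 0) = 0 := by
  rw [pivOK, Bool.and_eq_true, List.all_eq_true] at hP
  have h := hP.2 (cs[j]) (List.getElem_mem hj)
  rw [beq_iff_eq] at h
  rwa [List.getD_eq_getElem?_getD, List.getElem?_eq_getElem hj, Option.getD_some]
/-- **PRUNING SOUNDNESS**: every element of the column span reduces to `0`. -/
theorem red_selXor {cs : List ℕ} {P : Piv} (hP : pivOK cs P = true) (x : ℕ) : P.red (selXor cs x) = 0 := by
  rw [selXor, map_lin_of_xor P.red (red_zero P) (red_xor P)]
  rw [lin_congr (i0 := 0) (h := fun _ => 0) (fun j hj => by rw [Nat.zero_add]; exact pivOK_red hP hj) x]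
  exact lin_const_zero _ _ _

/-! ## Scan completeness -/
/-- At a leaf whose residual reduces to `0`, every listed solution is recorded. -/
theorem mem_scan_leaf (Pv : Piv) (MP : List ℕ) (O : List (ℕ × ℕ × ℕ)) (s v : ℕ) (e : List ℕ)
    (hO : O = [] ∨ s = 0) {x : ℕ} (hx : x ∈ Pv.solutions MP v) : (e, x) ∈ scan Pv MP O s v 0 e := by
  rcases hO with rfl | rfl
  · simp only [scan, beq_self_eq_true, if_true, List.mem_map]; exact ⟨x, hx, rfl⟩
  · cases O with
    | nil => simp only [scan, beq_self_eq_true, if_true, List.mem_map]; exact ⟨x, hx, rfl⟩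
    | cons oc O => simp only [scan, beq_self_eq_true, if_true, List.mem_map]; exact ⟨x, hx, rfl⟩
/-- **SCAN COMPLETENESS**: every sub-list `e'` of the outside triples within budget whose residual
reduces to `0`, and every listed solution there, is recorded (with the indices of `e'` reversed onto
the running prefix). -/
theorem scan_complete (Pv : Piv) (MP : List ℕ) (O : List (ℕ × ℕ × ℕ)) :
    ∀ (s v rv : ℕ) (e : List ℕ) (e' : List (ℕ × ℕ × ℕ)), e'.Sublist O →
      e'.length ≤ s → rv ^^^ xorIdx (fun oc => oc.2.2) e' = 0 →
      ∀ x ∈ Pv.solutions MP (v ^^^ xorIdx (fun oc => oc.2.1) e'),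
        ((e'.map Prod.fst).reverse ++ e, x) ∈ scan Pv MP O s v rv e := by
  induction O with
  | nil =>
    intro s v rv e e' he' _ hrv x hx
    rw [List.sublist_nil] at he'
    subst he'
    simp only [xorIdx_nil, Nat.xor_zero] at hx hrv
    subst hrv
    simpa using mem_scan_leaf Pv MP [] s v e (Or.inl rfl) hx
  | cons oc O ih =>
    intro s v rv e e' he' hlen hrv x hx
    cases s with
    | zero =>
      have he0 : e' = [] := List.eq_nil_of_length_eq_zero (Nat.le_zero.1 hlen)
      subst he0
      simp only [xorIdx_nil, Nat.xor_zero] at hx hrv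
      subst hrv
      simpa using mem_scan_leaf Pv MP (oc :: O) 0 v e (Or.inr rfl) hx
    | succ s' =>
      simp only [scan]
      cases he' with
      | cons _ he'' =>
        exact List.mem_append_right _ (ih (s' + 1) v rv e _ he'' hlen hrv x hx)
      | cons_cons _ he'' =>
        rename_i e''
        have hx' : x ∈ Pv.solutions MP ((v ^^^ oc.2.1) ^^^ xorIdx (fun oc => oc.2.1) e'') := by
          rw [xorIdx_cons, ← Nat.xor_assoc] at hx; exact hx
        have hrv' : (rv ^^^ oc.2.2) ^^^ xorIdx (fun oc => oc.2.2) e'' = 0 := by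
          rw [xorIdx_cons, ← Nat.xor_assoc] at hrv; exact hrv
        have := ih s' (v ^^^ oc.2.1) (rv ^^^ oc.2.2) (oc.1 :: e) e'' he'' (by simp at hlen; omega) hrv' x hx'
        refine List.mem_append_left _ ?_
        simpa [List.reverse_cons, List.append_assoc] using this
/-- **FIBRE ENUMERATOR, combinatorial completeness**: if `fiber` succeeds, every within-budget sub-list
of the outside positions (whose residual reduces to `0` when pruning is active), with a listed solution,
yields a recorded word. -/
theorem mem_fiber_of_solution (G : Geo) (M Mp : ℕ → ℕ) (W : ℕ) (P : List ℕ) {out : List (List ℕ)}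
    (hout : fiber G M Mp W P = some out) (e' : List ℕ)
    (he' : e'.Sublist (outsideOf G.ns P))
    (hlen : e'.length ≤ (W - P.length) / 2)
    (hred : 2 ≤ (W - P.length) / 2 → (gaussPiv (P.map M)).red (frhs Mp P ^^^ xorIdx M e') = 0) (x : ℕ)
    (hx : x ∈ (gaussPiv (P.map M)).solutions (P.map M) (frhs Mp P ^^^ xorIdx M e')) :
    mkWord G P e'.reverse x ∈ out := by
  unfold fiber at hout
  simp only at hout
  set Pv := gaussPiv (P.map M)
  by_cases hs : 2 ≤ (W - P.length) / 2
  · rw [if_pos hs] at hout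
    split at hout
    · simp only [Option.some.injEq] at hout
      subst hout
      rw [List.mem_map]
      refine ⟨(e'.reverse ++ [], x), ?_, by simp⟩
      have hsub : (e'.map fun o => (o, M o, Pv.red (M o))).Sublist
          ((outsideOf G.ns P).map fun o => (o, M o, Pv.red (M o))) := he'.map _
      have hx2 : x ∈ Pv.solutions (P.map M)
          (frhs Mp P ^^^ xorIdx (fun oc : ℕ × ℕ × ℕ => oc.2.1) (e'.map fun o => (o, M o, Pv.red (M o)))) := by
        rw [xorIdx_map]; exact hx
      have hrv : Pv.red (frhs Mp P) ^^^ xorIdx (fun oc : ℕ × ℕ × ℕ => oc.2.2)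
          (e'.map fun o => (o, M o, Pv.red (M o))) = 0 := by
        rw [xorIdx_map, ← hred hs, red_xor, red_xorIdx]; rfl
      have := scan_complete _ _ _ ((W - P.length) / 2) (frhs Mp P) _ [] _ hsub
        (by rw [List.length_map]; exact hlen) hrv x hx2
      rw [List.map_map] at this
      have hid : List.map (Prod.fst ∘ fun o => (o, M o, Pv.red (M o))) e' = e' := by
        rw [show (Prod.fst ∘ fun o => (o, M o, Pv.red (M o))) = id from rfl, List.map_id]
      rw [hid] at this
      exact this
    · simp at hout
  · rw [if_neg hs] at hout
    split at hout
    · simp only [Option.some.injEq] at hout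
      subst hout
      rw [List.mem_map]
      refine ⟨(e'.reverse ++ [], x), ?_, by simp⟩
      have hsub : (e'.map fun o => (o, M o, 0)).Sublist
          ((outsideOf G.ns P).map fun o => (o, M o, 0)) := he'.map _
      have hx2 : x ∈ Pv.solutions (P.map M)
          (frhs Mp P ^^^ xorIdx (fun oc : ℕ × ℕ × ℕ => oc.2.1) (e'.map fun o => (o, M o, 0))) := by
        rw [xorIdx_map]; exact hx
      have hrv : 0 ^^^ xorIdx (fun oc : ℕ × ℕ × ℕ => oc.2.2) (e'.map fun o => (o, M o, (0 : ℕ))) = 0 := by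
        rw [xorIdx_map, show ((fun oc : ℕ × ℕ × ℕ => oc.2.2) ∘ fun o => (o, M o, (0 : ℕ))) = fun _ => 0 from rfl,
          xorIdx_const_zero, Nat.xor_zero]
      have := scan_complete _ _ _ ((W - P.length) / 2) (frhs Mp P) _ [] _ hsub
        (by rw [List.length_map]; exact hlen) hrv x hx2
      rw [List.map_map] at this
      have hid : List.map (Prod.fst ∘ fun o => (o, M o, (0 : ℕ))) e' = e' := by
        rw [show (Prod.fst ∘ fun o => (o, M o, (0 : ℕ))) = id from rfl, List.map_id]
      rw [hid] at this
      exact this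
    · simp at hout
/-- If `fiber` succeeds, the core pivot structure verified; and the full one when pruning is active. -/
theorem pivOKcore_of_fiber (G : Geo) (M Mp : ℕ → ℕ) (W : ℕ) (P : List ℕ) {out : List (List ℕ)}
    (hout : fiber G M Mp W P = some out) : pivOKcore (P.map M) (gaussPiv (P.map M)) = true := by
  unfold fiber at hout
  simp only at hout
  split at hout
  · split at hout
    · exact pivOKcore_of_pivOK (by assumption)
    · simp at hout
  · split at hout
    · assumption
    · simp at hout
/-- `pivOK_of_fiber`: pivOK of fiber (auxiliary lemma of the fold-certificate soundness chain). -/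
theorem pivOK_of_fiber (G : Geo) (M Mp : ℕ → ℕ) (W : ℕ) (P : List ℕ) {out : List (List ℕ)}
    (hout : fiber G M Mp W P = some out) (hs : 2 ≤ (W - P.length) / 2) :
    pivOK (P.map M) (gaussPiv (P.map M)) = true := by
  unfold fiber at hout
  simp only at hout
  rw [if_pos hs] at hout
  split at hout
  · assumption
  · simp at hout

end Summit.Ventures.QEC.Census.Fold
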